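import Mathlib

/-!
# `FreeSubtorus.SubtorusCovering`, line `pair-sacrifice` — stub `stub_indepMatching`

Crux stmt-ValiantsHypothesis-16134 (`Summit.ValiantsHypothesis.ValiantsHypothesis.Theses.FreeSubtorus.SubtorusCovering`),
route `ValiantsHypothesis/FreeSubtorus`, line `pair-sacrifice`
(`Cruxes/SubtorusCovering/Lines/pair_sacrifice.lean`).

**Statement.**  For `Λ : Fin r → (Fin n ⊕ Fin n) → ℤ` with zero row-sums there are `s ≤ r` and
injections `ι κ : Fin s ↪ Fin n` (the sacrificed rows / columns) such that either `n ≤ s + 2`, or,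
for one `N > 0`, every column `N • Λ(·)(inl k)` and `N • Λ(·)(inr l)` is an integer combination of
the differences `Λ(·)(inl (ι j)) - Λ(·)(inr (κ j))`.

**Proof.**  Over `ℚ`, `a k = Λ(·)(inl k)`, `b l = Λ(·)(inr l)`; take a partial matching `(ι, κ)` of
MAXIMUM cardinality `s` with linearly independent differences `w t = a (ι t) - b (κ t)` (`s ≤ r`).
If `n ≥ s + 3`, every `a k - b l` lies in `S = span w`: maximality puts every FREE difference in `S`;
an escaping difference yields a matched row `ι j` with `a (ι j) - b l ∉ S` for all free `l` (or the
column-symmetric statement, via `(a, b, ι, κ) ↦ (-b, -a, κ, ι)`), and with a free row `k` and free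
columns `l ≠ l'` one of the re-matchings `{(ι j, l'), (k, l)}` / `{(ι j, l), (k, κ j)}` of pair `j`
is independent of size `s + 1` (`indepMatching_core`).  Zero row-sums give
`n • a k = Σ_{k'} (a k - a k') ∈ S`; clearing the finitely many denominators gives `N`.
-/

-- the mandated summit-side namespace repeats a component by design (single-conjunct summit)
set_option linter.dupNamespace false

namespace Summit.ValiantsHypothesis.ValiantsHypothesis.Theorems.FreeSubtorusSubtorusCovering

open Finset Submodule

/-! ### The augmentation step -/

/-- **Augmentation.**  Let `(ι, κ)` be a partial matching of size `s₀ + 1` with linearly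
independent differences `w t = a (ι t) - b (κ t)` such that NO partial matching of size `s₀ + 2`
has independent differences.  Then it is impossible to have a matched row `ι j`, a free row `k` and
two free columns `l ≠ l'` with `a k - b l ∈ span w` but `a (ι j) - b l ∉ span w` and
`a (ι j) - b l' ∉ span w`: one of the re-matchings `{(ι j, l'), (k, l)}` / `{(ι j, l), (k, κ j)}` of
the pair `j` would be independent of size `s₀ + 2`. [folklore] -/
theorem indepMatching_core {V : Type*} [AddCommGroup V] [Module ℚ V] {n s₀ : ℕ}
    (a b : Fin n → V) (ι κ : Fin (s₀ + 1) ↪ Fin n)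
    (hw : LinearIndependent ℚ (fun t => a (ι t) - b (κ t)))
    (hmax : ∀ ι' κ' : Fin (s₀ + 2) ↪ Fin n, ¬ LinearIndependent ℚ (fun t => a (ι' t) - b (κ' t)))
    (j : Fin (s₀ + 1)) {k l l' : Fin n} (hk : k ∉ Set.range ι) (hl : l ∉ Set.range κ)
    (hl' : l' ∉ Set.range κ) (hll' : l' ≠ l)
    (hkl : a k - b l ∈ span ℚ (Set.range fun t => a (ι t) - b (κ t)))
    (hxl : a (ι j) - b l ∉ span ℚ (Set.range fun t => a (ι t) - b (κ t)))
    (hxl' : a (ι j) - b l' ∉ span ℚ (Set.range fun t => a (ι t) - b (κ t))) : False := by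
  classical
  set w : Fin (s₀ + 1) → V := fun t => a (ι t) - b (κ t) with hwdef
  set S : Submodule ℚ V := span ℚ (Set.range w) with hS
  -- the matching without the pair `j`
  set wj : Fin s₀ → V := w ∘ j.succAbove with hwj
  set Sj : Submodule ℚ V := span ℚ (Set.range wj) with hSj
  have hwj_ind : LinearIndependent ℚ wj := hw.comp _ Fin.succAbove_right_injective
  have hSjS : Sj ≤ S := span_mono (Set.range_comp_subset_range _ _)
  have hwj_not : w j ∉ Sj := by
    have h := hw.notMem_span_image (s := Set.range j.succAbove) (x := j)
      (by rintro ⟨t, ht⟩; exact Fin.succAbove_ne j t ht)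
    rwa [← Set.range_comp] at h
  have hwjS : w j ∈ S := subset_span ⟨j, rfl⟩
  -- the new row injection `(ι j, k, ι ∘ succAbove)`
  have hιj_not : ι j ∉ Set.range (ι ∘ j.succAbove) := by
    rintro ⟨t, ht⟩; exact Fin.succAbove_ne j t (ι.injective ht)
  have hk_not : k ∉ Set.range (ι ∘ j.succAbove) := fun ⟨t, ht⟩ => hk ⟨_, ht⟩
  have hιk : ι j ≠ k := fun h => hk ⟨j, h⟩
  let fR : Fin (s₀ + 2) → Fin n := Fin.cons (ι j) (Fin.cons k (ι ∘ j.succAbove))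
  have hfR : Function.Injective fR := by
    refine Fin.cons_injective_iff.2 ⟨?_, Fin.cons_injective_iff.2 ⟨hk_not,
      ι.injective.comp Fin.succAbove_right_injective⟩⟩
    rw [Fin.range_cons]
    rintro (h | h)
    · exact hιk h
    · exact hιj_not h
  let ιR : Fin (s₀ + 2) ↪ Fin n := ⟨fR, hfR⟩
  -- generic column injection `(c₀, c₁, κ ∘ succAbove)`
  have hcol : ∀ c₀ c₁ : Fin n, c₀ ≠ c₁ → c₀ ∉ Set.range (κ ∘ j.succAbove) →
      c₁ ∉ Set.range (κ ∘ j.succAbove) →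
      Function.Injective (Fin.cons c₀ (Fin.cons c₁ (κ ∘ j.succAbove)) : Fin (s₀ + 2) → Fin n) := by
    intro c₀ c₁ hne h₀ h₁
    refine Fin.cons_injective_iff.2 ⟨?_, Fin.cons_injective_iff.2 ⟨h₁,
      κ.injective.comp Fin.succAbove_right_injective⟩⟩
    rw [Fin.range_cons]
    rintro (h | h)
    · exact hne h
    · exact h₀ h
  have hl_not : l ∉ Set.range (κ ∘ j.succAbove) := fun ⟨t, ht⟩ => hl ⟨_, ht⟩
  have hl'_not : l' ∉ Set.range (κ ∘ j.succAbove) := fun ⟨t, ht⟩ => hl' ⟨_, ht⟩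
  have hκj_not : κ j ∉ Set.range (κ ∘ j.succAbove) := by
    rintro ⟨t, ht⟩; exact Fin.succAbove_ne j t (κ.injective ht)
  have hlκ : l ≠ κ j := fun h => hl ⟨j, h.symm⟩
  -- the differences of a re-matching `(fR, cons c₀ (cons c₁ (κ ∘ succAbove)))`
  have hfam : ∀ c₀ c₁ : Fin n,
      (fun t : Fin (s₀ + 2) => a (fR t) - b ((Fin.cons c₀ (Fin.cons c₁ (κ ∘ j.succAbove)) :
          Fin (s₀ + 2) → Fin n) t)) =
        Fin.cons (a (ι j) - b c₀) (Fin.cons (a k - b c₁) wj) := by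
    intro c₀ c₁
    funext t
    refine Fin.cases ?_ (fun t => ?_) t
    · simp [fR]
    · refine Fin.cases ?_ (fun t => ?_) t
      · simp [fR]
      · simp [fR, hwj, hwdef]
  by_cases hcase : a k - b l ∈ Sj
  · -- move C: pairs `(ι j, l)` and `(k, κ j)`
    set y : V := a k - b (κ j) with hy
    have hE : a (ι j) - b l = w j + (a k - b l) - y := by
      simp only [hwdef, hy]; abel
    have hy_not : y ∉ Sj := fun hyS =>
      hxl (by rw [hE]; exact S.sub_mem (S.add_mem hwjS (hSjS hcase)) (hSjS hyS))
    have hx_not : a (ι j) - b l ∉ span ℚ (Set.range (Fin.cons y wj : Fin (s₀ + 1) → V)) := by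
      intro hx
      rw [Fin.range_cons, span_insert, Submodule.mem_sup] at hx
      obtain ⟨u, hu, σ, hσ, hsum⟩ := hx
      obtain ⟨q, rfl⟩ := mem_span_singleton.1 hu
      -- `x = q • y + σ`, `y = w j + (a k - b l) - x`
      by_cases hq : 1 + q = 0
      · have hq' : q = -1 := by linarith
        subst hq'
        apply hwj_not
        have : w j = σ - (a k - b l) := by
          have h1 : (-1 : ℚ) • y + σ = a (ι j) - b l := hsum
          rw [hE, neg_one_smul] at h1
          have h2 : w j = σ - (a k - b l) := by
            have := congrArg (fun z => z + y - (a k - b l)) h1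
            rw [show -y + σ + y - (a k - b l) = σ - (a k - b l) by abel,
              show w j + (a k - b l) - y + y - (a k - b l) = w j by abel] at this
            exact this.symm
          exact h2
        rw [this]
        exact Sj.sub_mem hσ hcase
      · apply hxl
        have h1 : q • y + σ = a (ι j) - b l := hsum
        have h2 : (1 + q) • (a (ι j) - b l) = q • w j + q • (a k - b l) + σ := by
          rw [add_smul, one_smul]
          nth_rewrite 1 [← h1]
          rw [hE, smul_sub q (w j + (a k - b l)) y, smul_add q (w j) (a k - b l)]
          abel
        have h3 : a (ι j) - b l = (1 + q)⁻¹ • (q • w j + q • (a k - b l) + σ) := by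
          rw [← h2, smul_smul, inv_mul_cancel₀ hq, one_smul]
        rw [h3]
        exact S.smul_mem _ (S.add_mem (S.add_mem (S.smul_mem _ hwjS) (S.smul_mem _ (hSjS hcase)))
          (hSjS hσ))
    refine hmax ιR ⟨_, hcol l (κ j) hlκ hl_not hκj_not⟩ ?_
    show LinearIndependent ℚ (fun t : Fin (s₀ + 2) => a (fR t) -
      b ((Fin.cons l (Fin.cons (κ j) (κ ∘ j.succAbove)) : Fin (s₀ + 2) → Fin n) t))
    rw [hfam l (κ j)]
    exact linearIndependent_finCons.2 ⟨linearIndependent_finCons.2 ⟨hwj_ind, hy_not⟩, hx_not⟩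
  · -- move A: pairs `(ι j, l')` and `(k, l)`
    have hx_not : a (ι j) - b l' ∉ span ℚ (Set.range (Fin.cons (a k - b l) wj : Fin (s₀ + 1) → V)) := by
      intro hx
      apply hxl'
      refine (span_le.2 ?_) hx
      rw [Fin.range_cons]
      rintro z (rfl | ⟨t, rfl⟩)
      · exact hkl
      · exact hSjS (subset_span ⟨t, rfl⟩)
    refine hmax ιR ⟨_, hcol l' l hll' hl'_not hl_not⟩ ?_
    show LinearIndependent ℚ (fun t : Fin (s₀ + 2) => a (fR t) -
      b ((Fin.cons l' (Fin.cons l (κ ∘ j.succAbove)) : Fin (s₀ + 2) → Fin n) t))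
    rw [hfam l' l]
    exact linearIndependent_finCons.2 ⟨linearIndependent_finCons.2 ⟨hwj_ind, hcase⟩, hx_not⟩

/-! ### Spanning from a maximum independent matching -/

/-- **Spanning.**  If `(ι, κ)` is a partial matching of size `s` with linearly independent
differences, no partial matching of size `s + 1` has independent differences, and at least three
rows are free (`s + 3 ≤ n`), then EVERY difference `a k - b l` lies in the span of the matched
differences. [folklore] -/
theorem indepMatching_span {V : Type*} [AddCommGroup V] [Module ℚ V] {n s : ℕ}
    (a b : Fin n → V) (ι κ : Fin s ↪ Fin n)
    (hw : LinearIndependent ℚ (fun t => a (ι t) - b (κ t)))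
    (hmax : ∀ ι' κ' : Fin (s + 1) ↪ Fin n, ¬ LinearIndependent ℚ (fun t => a (ι' t) - b (κ' t)))
    (hn : s + 3 ≤ n) :
    ∀ k l, a k - b l ∈ span ℚ (Set.range fun t => a (ι t) - b (κ t)) := by
  classical
  set w : Fin s → V := fun t => a (ι t) - b (κ t) with hwdef
  set S : Submodule ℚ V := span ℚ (Set.range w) with hS
  -- two free rows and two free columns
  have hfree : ∀ φ : Fin s ↪ Fin n, ∃ x₀ x₁ : Fin n, x₀ ≠ x₁ ∧ x₀ ∉ Set.range φ ∧ x₁ ∉ Set.range φ := by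
    intro φ
    have hin : (univ.filter fun x : Fin n => x ∈ Set.range φ).card = s := by
      have : (univ.filter fun x : Fin n => x ∈ Set.range φ) = univ.map φ := by
        ext x; simp [Set.mem_range, eq_comm]
      rw [this, card_map, card_univ, Fintype.card_fin]
    have h2 := Finset.card_filter_add_card_filter_not (s := (univ : Finset (Fin n)))
      (fun x : Fin n => x ∈ Set.range φ)
    rw [hin, card_univ, Fintype.card_fin] at h2
    have hcard : 1 < (univ.filter fun x : Fin n => ¬ x ∈ Set.range φ).card := by omega
    obtain ⟨x₀, hx₀, x₁, hx₁, hne⟩ := Finset.one_lt_card.1 hcard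
    simp only [mem_filter, mem_univ, true_and] at hx₀ hx₁
    exact ⟨x₀, x₁, hne, hx₀, hx₁⟩
  obtain ⟨k₀, k₁, hk01, hk₀, hk₁⟩ := hfree ι
  obtain ⟨l₀, l₁, hl01, hl₀, hl₁⟩ := hfree κ
  -- (1) every FREE difference lies in `S` (else add the pair)
  have hfreeS : ∀ k l, k ∉ Set.range ι → l ∉ Set.range κ → a k - b l ∈ S := by
    intro k l hk hl
    by_contra hkl
    refine hmax ⟨Fin.cons k ι, Fin.cons_injective_iff.2 ⟨hk, ι.injective⟩⟩
      ⟨Fin.cons l κ, Fin.cons_injective_iff.2 ⟨hl, κ.injective⟩⟩ ?_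
    have hfam : (fun t : Fin (s + 1) => a ((Fin.cons k ι : Fin (s + 1) → Fin n) t) -
        b ((Fin.cons l κ : Fin (s + 1) → Fin n) t)) = Fin.cons (a k - b l) w := by
      funext t
      refine Fin.cases ?_ (fun t => ?_) t
      · simp
      · simp [hwdef]
    show LinearIndependent ℚ (fun t : Fin (s + 1) => a ((Fin.cons k ι : Fin (s + 1) → Fin n) t) -
        b ((Fin.cons l κ : Fin (s + 1) → Fin n) t))
    rw [hfam]
    exact linearIndependent_finCons.2 ⟨hw, hkl⟩
  -- (2) suppose some difference escapes
  by_contra hnot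
  push Not at hnot
  obtain ⟨k, l, hkl⟩ := hnot
  -- a ROW witness `a (ι j) - b l₀ ∉ S` or a COLUMN witness `a k₀ - b (κ j) ∉ S`
  have hwit : (∃ j, a (ι j) - b l₀ ∉ S) ∨ (∃ j, a k₀ - b (κ j) ∉ S) := by
    by_cases hk : k ∈ Set.range ι
    · obtain ⟨j, rfl⟩ := hk
      by_cases hrow : a (ι j) - b l₀ ∈ S
      · -- then `l` is matched and gives a column witness
        by_cases hl : l ∈ Set.range κ
        · obtain ⟨j', rfl⟩ := hl
          refine Or.inr ⟨j', fun h => hkl ?_⟩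
          have : a (ι j) - b (κ j') = (a (ι j) - b l₀) - (a k₀ - b l₀) + (a k₀ - b (κ j')) := by abel
          rw [this]
          exact S.add_mem (S.sub_mem hrow (hfreeS k₀ l₀ hk₀ hl₀)) h
        · exfalso; apply hkl
          have : a (ι j) - b l = (a (ι j) - b l₀) - (a k₀ - b l₀) + (a k₀ - b l) := by abel
          rw [this]
          exact S.add_mem (S.sub_mem hrow (hfreeS k₀ l₀ hk₀ hl₀)) (hfreeS k₀ l hk₀ hl)
      · exact Or.inl ⟨j, hrow⟩
    · by_cases hl : l ∈ Set.range κ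
      · obtain ⟨j', rfl⟩ := hl
        refine Or.inr ⟨j', fun h => hkl ?_⟩
        have : a k - b (κ j') = (a k - b l₀) - (a k₀ - b l₀) + (a k₀ - b (κ j')) := by abel
        rw [this]
        exact S.add_mem (S.sub_mem (hfreeS k l₀ hk hl₀) (hfreeS k₀ l₀ hk₀ hl₀)) h
      · exact (hkl (hfreeS k l hk hl)).elim
  -- `s ≥ 1`
  rcases hwit with ⟨j, hj⟩ | ⟨j, hj⟩
  · obtain ⟨s₀, rfl⟩ : ∃ s₀, s = s₀ + 1 := ⟨s - 1, by have := j.pos; omega⟩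
    -- row witness: `a (ι j) - b l ∉ S` for every free `l`
    have hx : ∀ l'', l'' ∉ Set.range κ → a (ι j) - b l'' ∉ S := by
      intro l'' hl'' h
      apply hj
      have : a (ι j) - b l₀ = (a (ι j) - b l'') - (a k₀ - b l'') + (a k₀ - b l₀) := by abel
      rw [this]
      exact S.add_mem (S.sub_mem h (hfreeS k₀ l'' hk₀ hl'')) (hfreeS k₀ l₀ hk₀ hl₀)
    exact indepMatching_core a b ι κ hw hmax j hk₀ hl₀ hl₁ hl01.symm (hfreeS k₀ l₀ hk₀ hl₀)
      (hx l₀ hl₀) (hx l₁ hl₁)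
  · obtain ⟨s₀, rfl⟩ : ∃ s₀, s = s₀ + 1 := ⟨s - 1, by have := j.pos; omega⟩
    -- column witness: apply the core to the transposed data `(-b, -a, κ, ι)`
    have hx : ∀ k'', k'' ∉ Set.range ι → a k'' - b (κ j) ∉ S := by
      intro k'' hk'' h
      apply hj
      have : a k₀ - b (κ j) = (a k₀ - b l₀) - (a k'' - b l₀) + (a k'' - b (κ j)) := by abel
      rw [this]
      exact S.add_mem (S.sub_mem (hfreeS k₀ l₀ hk₀ hl₀) (hfreeS k'' l₀ hk'' hl₀)) h
    have key := indepMatching_core (fun l => -b l) (fun k => -a k) κ ι (s₀ := s₀)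
      (k := l₀) (l := k₀) (l' := k₁)
    simp only [neg_sub_neg] at key
    refine key hw (fun ι' κ' h => hmax κ' ι' h) j hl₀ hk₀ hk₁ hk01.symm (hfreeS k₀ l₀ hk₀ hl₀)
      (hx k₀ hk₀) (hx k₁ hk₁)

/-! ### The stub -/

/-- **`stub_indepMatching`** (line `pair-sacrifice` of crux `SubtorusCovering`): a maximum
independent partial matching of the differences `Λ(·)(inl k) - Λ(·)(inr l)` has size `s ≤ r` and
either leaves at most two rows free (`n ≤ s + 2`) or — by `indepMatching_span` and the zero
row-sums, `n • a_k = Σ_{k'} (a_k - a_{k'})` — spans every column of `Λ` over `ℚ`; clearing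
denominators gives one `N > 0` and integer coefficients. [folklore] -/
theorem stub_indepMatching :
    ∀ (n r : ℕ) (Λ : Fin r → (Fin n ⊕ Fin n) → ℤ),
    (∀ i, (∑ k, Λ i (Sum.inl k)) = 0) →
    ∃ (s : ℕ) (ι κ : Fin s ↪ Fin n), s ≤ r ∧
      (n ≤ s + 2 ∨
        ∃ N : ℕ, 0 < N ∧
          (∀ k : Fin n, ∃ a : Fin s → ℤ, ∀ i,
            (N : ℤ) * Λ i (Sum.inl k) =
              ∑ j, a j * (Λ i (Sum.inl (ι j)) - Λ i (Sum.inr (κ j)))) ∧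
          (∀ l : Fin n, ∃ a : Fin s → ℤ, ∀ i,
            (N : ℤ) * Λ i (Sum.inr l) =
              ∑ j, a j * (Λ i (Sum.inl (ι j)) - Λ i (Sum.inr (κ j))))) := by
  intro n r Λ hrow
  classical
  -- the columns of `Λ` over `ℚ`
  let a : Fin n → (Fin r → ℚ) := fun k i => (Λ i (Sum.inl k) : ℚ)
  let b : Fin n → (Fin r → ℚ) := fun l i => (Λ i (Sum.inr l) : ℚ)
  -- independent matchings and a maximum one
  let P : ℕ → Prop := fun s => ∃ ι κ : Fin s ↪ Fin n, LinearIndependent ℚ (fun t => a (ι t) - b (κ t))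
  have hP0 : P 0 :=
    ⟨Function.Embedding.ofIsEmpty, Function.Embedding.ofIsEmpty, linearIndependent_empty_type⟩
  have hPb : ∀ s, P s → s ≤ r := by
    rintro s ⟨ι, κ, h⟩
    have := h.fintype_card_le_finrank
    simpa using this
  obtain ⟨s, ⟨ι, κ, hw⟩, hmax⟩ : ∃ s, P s ∧ ∀ s', P s' → s' ≤ s :=
    ⟨Nat.findGreatest P r, Nat.findGreatest_spec (P := P) (Nat.zero_le r) hP0,
      fun s' hs' => Nat.le_findGreatest (hPb s' hs') hs'⟩
  refine ⟨s, ι, κ, hPb s ⟨ι, κ, hw⟩, ?_⟩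
  by_cases hdeg : n ≤ s + 2
  · exact Or.inl hdeg
  right
  set w : Fin s → (Fin r → ℚ) := fun t => a (ι t) - b (κ t) with hwdef
  set S : Submodule ℚ (Fin r → ℚ) := span ℚ (Set.range w) with hS
  have hmax' : ∀ ι' κ' : Fin (s + 1) ↪ Fin n, ¬ LinearIndependent ℚ (fun t => a (ι' t) - b (κ' t)) :=
    fun ι' κ' h => absurd (hmax (s + 1) ⟨ι', κ', h⟩) (by omega)
  have hspan : ∀ k l, a k - b l ∈ S := indepMatching_span a b ι κ hw hmax' (by omega)
  -- zero row-sums: every column lies in `S`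
  have hn0 : (n : ℚ) ≠ 0 := by exact_mod_cast (show n ≠ 0 by omega)
  let l₀ : Fin n := ⟨0, by omega⟩
  have hsum0 : ∑ k, a k = 0 := by
    funext i
    rw [Finset.sum_apply]
    simp only [a, Pi.zero_apply]
    exact_mod_cast hrow i
  have ha : ∀ k, a k ∈ S := by
    intro k
    have hsum : (n : ℚ) • a k = ∑ k', (a k - a k') := by
      rw [Finset.sum_sub_distrib, hsum0, sub_zero, Finset.sum_const, card_univ, Fintype.card_fin,
        Nat.cast_smul_eq_nsmul]
    have hmem : (n : ℚ) • a k ∈ S := by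
      rw [hsum]
      refine S.sum_mem fun k' _ => ?_
      have : a k - a k' = (a k - b l₀) - (a k' - b l₀) := by abel
      rw [this]
      exact S.sub_mem (hspan k l₀) (hspan k' l₀)
    have := S.smul_mem (n : ℚ)⁻¹ hmem
    rwa [smul_smul, inv_mul_cancel₀ hn0, one_smul] at this
  have hb : ∀ l, b l ∈ S := fun l => by
    have : b l = a l₀ - (a l₀ - b l) := by abel
    rw [this]
    exact S.sub_mem (ha l₀) (hspan l₀ l)
  -- coordinates and a common denominator
  have hcoef : ∀ x ∈ S, ∃ c : Fin s → ℚ, x = ∑ t, c t • w t := fun x hx => by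
    obtain ⟨c, hc⟩ := (Submodule.mem_span_range_iff_exists_fun ℚ).1 hx
    exact ⟨c, hc.symm⟩
  choose ca hca using fun k => hcoef (a k) (ha k)
  choose cb hcb using fun l => hcoef (b l) (hb l)
  set N : ℕ := (∏ k, ∏ t, (ca k t).den) * ∏ l, ∏ t, (cb l t).den with hN
  have hNpos : 0 < N := by
    refine Nat.pos_of_ne_zero ?_
    simp only [hN, mul_ne_zero_iff, Finset.prod_ne_zero_iff]
    exact ⟨fun k _ t _ => (ca k t).den_nz, fun l _ t _ => (cb l t).den_nz⟩
  -- evaluation of a coordinate expansion at `i`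
  have heval : ∀ (x : Fin r → ℚ) (c : Fin s → ℚ), x = ∑ t, c t • w t → ∀ i,
      (N : ℚ) * x i = ∑ t, ((N : ℚ) * c t) *
        ((Λ i (Sum.inl (ι t)) : ℚ) - (Λ i (Sum.inr (κ t)) : ℚ)) := by
    intro x c hx i
    rw [hx, Finset.sum_apply, Finset.mul_sum]
    refine Finset.sum_congr rfl fun t _ => ?_
    simp only [Pi.smul_apply, hwdef, Pi.sub_apply, smul_eq_mul, a, b]
    ring
  -- clearing one coordinate vector
  have hclear : ∀ c : Fin s → ℚ, (∀ t, (c t).den ∣ N) →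
      ∃ z : Fin s → ℤ, ∀ t, ((z t : ℤ) : ℚ) = (N : ℚ) * c t := by
    intro c hc
    refine ⟨fun t => ((N / (c t).den : ℕ) : ℤ) * (c t).num, fun t => ?_⟩
    obtain ⟨m, hm⟩ := hc t
    have hden : (c t).den ≠ 0 := (c t).den_nz
    have hdiv : N / (c t).den = m := by
      rw [hm, Nat.mul_div_cancel_left _ (Nat.pos_of_ne_zero hden)]
    dsimp only
    rw [hdiv]
    push_cast
    rw [hm]
    push_cast
    rw [← Rat.mul_den_eq_num (c t)]
    ring
  refine ⟨N, hNpos, fun k => ?_, fun l => ?_⟩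
  · have hdvd : ∀ t, (ca k t).den ∣ N := fun t =>
      ((Finset.dvd_prod_of_mem (fun t => (ca k t).den) (mem_univ t)).trans
        (Finset.dvd_prod_of_mem (fun k => ∏ t, (ca k t).den) (mem_univ k))).mul_right _
    obtain ⟨z, hz⟩ := hclear (ca k) hdvd
    refine ⟨z, fun i => ?_⟩
    have key := heval (a k) (ca k) (hca k) i
    have : ((((N : ℤ) * Λ i (Sum.inl k) : ℤ)) : ℚ) =
        ((∑ j, z j * (Λ i (Sum.inl (ι j)) - Λ i (Sum.inr (κ j))) : ℤ) : ℚ) := by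
      push_cast
      rw [key]
      refine Finset.sum_congr rfl fun t _ => ?_
      rw [hz t]
    exact_mod_cast this
  · have hdvd : ∀ t, (cb l t).den ∣ N := fun t =>
      ((Finset.dvd_prod_of_mem (fun t => (cb l t).den) (mem_univ t)).trans
        (Finset.dvd_prod_of_mem (fun l => ∏ t, (cb l t).den) (mem_univ l))).mul_left _
    obtain ⟨z, hz⟩ := hclear (cb l) hdvd
    refine ⟨z, fun i => ?_⟩
    have key := heval (b l) (cb l) (hcb l) i
    have : ((((N : ℤ) * Λ i (Sum.inr l) : ℤ)) : ℚ) =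
        ((∑ j, z j * (Λ i (Sum.inl (ι j)) - Λ i (Sum.inr (κ j))) : ℤ) : ℚ) := by
      push_cast
      rw [key]
      refine Finset.sum_congr rfl fun t _ => ?_
      rw [hz t]
    exact_mod_cast this

end Summit.ValiantsHypothesis.ValiantsHypothesis.Theorems.FreeSubtorusSubtorusCovering
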